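import Summits.CriticalPhenomena.SAWScalingLimit.Theorems.SAWDevelopingMapObservableToSLECanonicalTransferLatticePaths
import Literature.Probability.Percolation.SitePaths
import HarnessLib

/-!
# Crux `SAWDevelopingMap.ObservableToSLE` (stmt-CriticalPhenomena-10472), line
`floor-ratio-restriction-bootstrap`, stub `stub_canonicalTransfer`: lattice walks along
preconnected sets (lattice topology for the inner admissible discretisation (M1))

Landing target:
`Summits/CriticalPhenomena/SAWScalingLimit/Theorems/SAWDevelopingMapObservableToSLECanonicalTransferLatticeChains.lean`
(`--supports stmt-CriticalPhenomena-10472`).  Sequel of `…CanonicalTransferGreedy.lean` and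
`…CanonicalTransferLatticePaths.lean`.

The discretisation (M1) repeatedly needs: *lattice vertices near two points of a connected planar
set are joined by a honeycomb walk staying near the set* (exhaustion of compacts through the bulk,
escape of boundary-collar vertices through the exterior of the Jordan curve, connectivity outside a
large disc).  With greedy descent this is an `ε`-chain argument, run here abstractly through
`IsPreconnected.induction₂`:

* `dist_smul_hexCenter`, `exists_walk_smul_dist_le_dist`, `exists_vertex_dist_le` — rescaled
  forms of the walk towards a vertex and existence of a lattice vertex within `δ/√3` of any point;
* `exists_walk_near_of_isPreconnected` = registered sub-goal `stub_canonicalTransfer_latticeChain` —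
  for a preconnected `s ⊆ ℂ`, mesh `0 < δ ≤ r`, points `x, y ∈ s` and vertices `v`, `w` with
  `dist (δ c_v) x ≤ r`, `dist (δ c_w) y ≤ r`, there is a honeycomb walk from `v` to `w` all of whose
  vertices are within `4r` of `s`;
* `pathIn_of_walk`, `pathIn_far` — walks to `PathIn` chains; **any two vertices of norm
  `≥ R + 5δ` are joined by a lattice path avoiding every set of vertices of norm `< R`** (radially
  out to a common circle, then along it: the "far set" input of `exists_fill`).
-/

noncomputable section

open scoped Topology
open Filter Set Metric
open Literature.Probability.LatticeModels (HexVertex hexGraph hexCenter Site)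
open Literature.Probability.RandomPlanarGeometry
open Literature.Probability.RandomPlanarGeometry.SAW
open Literature.Probability.Percolation (PathIn)

namespace Summit.CriticalPhenomena.SAWScalingLimit.Theorems.ObservableToSLE.FloorRatio

/-! ### Rescaled forms -/

/-- `dist (δ c_a) (δ c_b) = δ · dist (c_a) (c_b)` for `δ ≥ 0`. [folklore] -/
theorem dist_smul_hexCenter {δ : ℝ} (hδ : 0 ≤ δ) (a b : HexVertex) :
    dist ((δ : ℂ) * hexCenter a) ((δ : ℂ) * hexCenter b) = δ * dist (hexCenter a) (hexCenter b) := by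
  rw [dist_eq_norm, ← mul_sub, norm_mul, Complex.norm_real, Real.norm_of_nonneg hδ, ← dist_eq_norm]

/-- Rescaled walk towards a vertex: all vertices of the walk are at distance `≤ dist (δ c_v) (δ c_w)`
from `δ c_w`. [folklore] -/
theorem exists_walk_smul_dist_le_dist {δ : ℝ} (hδ : 0 ≤ δ) (v w : HexVertex) :
    ∃ p : hexGraph.Walk v w, ∀ u ∈ p.support,
      dist ((δ : ℂ) * hexCenter u) ((δ : ℂ) * hexCenter w) ≤
        dist ((δ : ℂ) * hexCenter v) ((δ : ℂ) * hexCenter w) := by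
  obtain ⟨p, hp⟩ := exists_walk_dist_le_dist v w
  refine ⟨p, fun u hu => ?_⟩
  rw [dist_smul_hexCenter hδ, dist_smul_hexCenter hδ]
  exact mul_le_mul_of_nonneg_left (hp u hu) hδ

/-- **Every point of the plane is within one rescaled edge length `δ/√3 ≤ δ` of a lattice
vertex.** [folklore] -/
theorem exists_vertex_dist_le {δ : ℝ} (hδ : 0 < δ) (y : ℂ) :
    ∃ z : HexVertex, dist ((δ : ℂ) * hexCenter z) y ≤ δ := by
  obtain ⟨z, -, hz, -⟩ := exists_walk_dist_smul_le hδ ((0 : Site 2), (0 : Fin 2)) y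
  refine ⟨z, hz.trans (div_le_self hδ.le ?_)⟩
  rw [show (1 : ℝ) = Real.sqrt 1 by simp]
  exact Real.sqrt_le_sqrt (by norm_num)

/-! ### Walks along a preconnected set -/

/-- **Lattice walks along a preconnected set** (named form of the registered sub-goal
`stub_canonicalTransfer_latticeChain`).  Let `s ⊆ ℂ` be preconnected, `0 < δ ≤ r`, `x, y ∈ s`, and
let `v`, `w` be honeycomb vertices with `dist (δ c_v) x ≤ r`, `dist (δ c_w) y ≤ r`.  Then there is
a honeycomb walk from `v` to `w` all of whose vertices are within `4r` of a point of `s`.  (The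
relation "lattice vertices near `x` and near `y` are so joined" is symmetric, transitive — through a
lattice vertex within `δ ≤ r` of the middle point — and holds for `y ∈ B(x, r) ∩ s` by the walk
towards a vertex; conclude by `IsPreconnected.induction₂`.) [folklore] -/
theorem exists_walk_near_of_isPreconnected {s : Set ℂ} (hs : IsPreconnected s) {δ r : ℝ}
    (hδ : 0 < δ) (hδr : δ ≤ r) {x y : ℂ} (hx : x ∈ s) (hy : y ∈ s) {v w : HexVertex}
    (hv : dist ((δ : ℂ) * hexCenter v) x ≤ r) (hw : dist ((δ : ℂ) * hexCenter w) y ≤ r) :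
    ∃ p : hexGraph.Walk v w, ∀ u ∈ p.support, ∃ z ∈ s, dist ((δ : ℂ) * hexCenter u) z < 4 * r := by
  have hr : 0 < r := hδ.trans_le hδr
  -- the relation
  let P : ℂ → ℂ → Prop := fun x y => ∀ v w : HexVertex, dist ((δ : ℂ) * hexCenter v) x ≤ r →
    dist ((δ : ℂ) * hexCenter w) y ≤ r →
    ∃ p : hexGraph.Walk v w, ∀ u ∈ p.support, ∃ z ∈ s, dist ((δ : ℂ) * hexCenter u) z < 4 * r
  suffices h : P x y from h v w hv hw
  refine hs.induction₂ P (fun x hx => ?_) (fun x y z _ hy _ hxy hyz v w hv hw => ?_)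
    (fun x y _ _ hxy v w hv hw => ?_) hx hy
  · -- local: `y ∈ B(x, r) ∩ s`
    have hmem : s ∩ ball x r ∈ 𝓝[s] x := inter_mem_nhdsWithin s (ball_mem_nhds x hr)
    filter_upwards [hmem] with y hy v w hv hw
    obtain ⟨p, hp⟩ := exists_walk_smul_dist_le_dist hδ.le v w
    refine ⟨p, fun u hu => ⟨y, hy.1, ?_⟩⟩
    have h1 : dist ((δ : ℂ) * hexCenter v) ((δ : ℂ) * hexCenter w) < 3 * r := by
      calc dist ((δ : ℂ) * hexCenter v) ((δ : ℂ) * hexCenter w)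
          ≤ dist ((δ : ℂ) * hexCenter v) x + dist x y + dist y ((δ : ℂ) * hexCenter w) :=
            dist_triangle4 _ _ _ _
        _ < r + r + r := by
            refine add_lt_add_of_lt_of_le (add_lt_add_of_le_of_lt hv ?_) (by rwa [dist_comm])
            rw [dist_comm]; exact mem_ball.1 hy.2
        _ = 3 * r := by ring
    calc dist ((δ : ℂ) * hexCenter u) y
        ≤ dist ((δ : ℂ) * hexCenter u) ((δ : ℂ) * hexCenter w) + dist ((δ : ℂ) * hexCenter w) y :=
          dist_triangle _ _ _
      _ < 3 * r + r := add_lt_add_of_lt_of_le ((hp u hu).trans_lt h1) hw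
      _ = 4 * r := by ring
  · -- transitive: through a lattice vertex within `δ ≤ r` of `y`
    obtain ⟨m, hm⟩ := exists_vertex_dist_le hδ y
    obtain ⟨p, hp⟩ := hxy v m hv (hm.trans hδr)
    obtain ⟨q, hq⟩ := hyz m w (hm.trans hδr) hw
    refine ⟨p.append q, fun u hu => ?_⟩
    rw [SimpleGraph.Walk.mem_support_append_iff] at hu
    rcases hu with hu | hu
    · exact hp u hu
    · exact hq u hu
  · -- symmetric: reverse the walk
    obtain ⟨p, hp⟩ := hxy w v hw hv
    refine ⟨p.reverse, fun u hu => hp u ?_⟩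
    rwa [SimpleGraph.Walk.support_reverse, List.mem_reverse] at hu

/-- **Registered sub-goal `stub_canonicalTransfer_latticeChain`** (crux item stmt-CriticalPhenomena-10472,
line `floor-ratio-restriction-bootstrap`, stub `stub_canonicalTransfer`): lattice walks along a
preconnected set, registry form of `exists_walk_near_of_isPreconnected`. [folklore] -/
theorem stub_canonicalTransfer_latticeChain :
    ∀ (s : Set ℂ) (δ r : ℝ) (x y : ℂ) (v w : HexVertex), IsPreconnected s → 0 < δ → δ ≤ r →
    x ∈ s → y ∈ s → dist ((δ : ℂ) * hexCenter v) x ≤ r → dist ((δ : ℂ) * hexCenter w) y ≤ r →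
    ∃ p : hexGraph.Walk v w, ∀ u ∈ p.support, ∃ z ∈ s, dist ((δ : ℂ) * hexCenter u) z < 4 * r :=
  fun _ _ _ _ _ _ _ hs hδ hδr hx hy hv hw => exists_walk_near_of_isPreconnected hs hδ hδr hx hy hv hw

/-! ### Far vertices are joined outside a disc -/

/-- A walk all of whose vertices lie in `A` is a `PathIn` chain inside `A`. [folklore] -/
theorem pathIn_of_walk {V : Type*} {Γ : SimpleGraph V} {A : Set V} {u v : V} (p : Γ.Walk u v)
    (h : ∀ x ∈ p.support, x ∈ A) : PathIn Γ A u v := by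
  induction p with
  | nil => exact PathIn.refl (h _ (by simp))
  | @cons a b c hadj q ih =>
    have ha : a ∈ A := h a (by simp)
    have hq : ∀ x ∈ q.support, x ∈ A := fun x hx => h x (by simp [hx])
    exact (PathIn.of_adj ha (hq b q.start_mem_support) hadj).trans (ih hq)

/-- **Radial escape.**  A vertex `w` of norm `‖δ c_w‖ ≥ R + 5δ` is joined, by a lattice path all
of whose vertices have norm `> R`, to a vertex within `δ` of the point of norm `M ≥ ‖δ c_w‖` on
its ray. [folklore] -/
theorem exists_pathIn_radial {B : Set HexVertex} {δ R M : ℝ} (hδ : 0 < δ) (hR : 0 ≤ R)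
    (hB : ∀ b ∈ B, ‖(δ : ℂ) * hexCenter b‖ < R) {w : HexVertex}
    (hw : R + 5 * δ ≤ ‖(δ : ℂ) * hexCenter w‖) (hM : ‖(δ : ℂ) * hexCenter w‖ ≤ M) :
    ∃ m : HexVertex,
      dist ((δ : ℂ) * hexCenter m) (((M / ‖(δ : ℂ) * hexCenter w‖ : ℝ) : ℂ) * ((δ : ℂ) * hexCenter w)) ≤ δ ∧
      PathIn hexGraph Bᶜ w m := by
  set a : ℂ := (δ : ℂ) * hexCenter w with ha
  have ha0 : 0 < ‖a‖ := by linarith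
  set t : ℝ := M / ‖a‖ with ht
  have ht1 : 1 ≤ t := by rwa [ht, le_div_iff₀ ha0, one_mul]
  -- the radial segment `{θ a : θ ∈ [1, t]}`
  set s : Set ℂ := (fun θ : ℝ => (θ : ℂ) * a) '' Icc 1 t with hs
  have hsc : IsPreconnected s :=
    isPreconnected_Icc.image _ ((Complex.continuous_ofReal.mul continuous_const).continuousOn)
  have hnorm : ∀ z ∈ s, ‖a‖ ≤ ‖z‖ := by
    rintro _ ⟨θ, hθ, rfl⟩
    show ‖a‖ ≤ ‖(θ : ℂ) * a‖
    rw [norm_mul (θ : ℂ) a, Complex.norm_real, Real.norm_of_nonneg (zero_le_one.trans hθ.1)]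
    exact le_mul_of_one_le_left (norm_nonneg _) hθ.1
  have hx : a ∈ s := ⟨1, ⟨le_rfl, ht1⟩, by simp⟩
  have hy : ((t : ℝ) : ℂ) * a ∈ s := ⟨t, ⟨ht1, le_rfl⟩, rfl⟩
  obtain ⟨m, hm⟩ := exists_vertex_dist_le hδ (((t : ℝ) : ℂ) * a)
  obtain ⟨p, hp⟩ := exists_walk_near_of_isPreconnected hsc hδ le_rfl hx hy
    (v := w) (by rw [ha, dist_self]; exact hδ.le) hm
  refine ⟨m, hm, pathIn_of_walk p fun u hu huB => ?_⟩
  obtain ⟨z, hz, hd⟩ := hp u hu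
  have h1 := hnorm z hz
  have h2 := hB u huB
  have h3 : ‖z‖ ≤ ‖(δ : ℂ) * hexCenter u‖ + dist ((δ : ℂ) * hexCenter u) z := by
    rw [dist_comm, dist_eq_norm]; exact norm_le_norm_add_norm_sub' z _
  linarith

/-- **Far vertices are joined outside a disc.**  If every vertex of `B` has norm `< R` at mesh
`δ`, any two vertices of norm `≥ R + 5δ` are joined by a lattice path avoiding `B` (radially out to
the circle of radius `M = max` of the two norms, then along that circle; all vertices met have
norm `> R`). This is the "far set" input of `exists_fill`. [folklore] -/
theorem pathIn_far {B : Set HexVertex} {δ R : ℝ} (hδ : 0 < δ) (hR : 0 ≤ R)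
    (hB : ∀ b ∈ B, ‖(δ : ℂ) * hexCenter b‖ < R) {w₁ w₂ : HexVertex}
    (h₁ : R + 5 * δ ≤ ‖(δ : ℂ) * hexCenter w₁‖) (h₂ : R + 5 * δ ≤ ‖(δ : ℂ) * hexCenter w₂‖) :
    PathIn hexGraph Bᶜ w₁ w₂ := by
  set M : ℝ := max ‖(δ : ℂ) * hexCenter w₁‖ ‖(δ : ℂ) * hexCenter w₂‖ with hMdef
  obtain ⟨m₁, hm₁, hp₁⟩ := exists_pathIn_radial hδ hR hB h₁ (le_max_left _ _)
  obtain ⟨m₂, hm₂, hp₂⟩ := exists_pathIn_radial hδ hR hB h₂ (le_max_right _ _)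
  -- along the circle of radius `M`
  have hMpos : 0 ≤ M := (norm_nonneg _).trans (le_max_left _ _)
  have hsph : ∀ {w : HexVertex}, R + 5 * δ ≤ ‖(δ : ℂ) * hexCenter w‖ →
      (((M / ‖(δ : ℂ) * hexCenter w‖ : ℝ) : ℂ) * ((δ : ℂ) * hexCenter w)) ∈ sphere (0 : ℂ) M := by
    intro w hw
    have h0 : 0 < ‖(δ : ℂ) * hexCenter w‖ := by linarith
    rw [mem_sphere_zero_iff_norm, norm_mul, Complex.norm_real, Real.norm_of_nonneg
      (div_nonneg hMpos h0.le), div_mul_cancel₀ _ h0.ne']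
  obtain ⟨q, hq⟩ := exists_walk_near_of_isPreconnected
    (isPreconnected_sphere (by rw [Complex.rank_real_complex]; norm_num) (0 : ℂ) M) hδ le_rfl
    (hsph h₁) (hsph h₂) hm₁ hm₂
  have hq' : PathIn hexGraph Bᶜ m₁ m₂ := by
    refine pathIn_of_walk q fun u hu huB => ?_
    obtain ⟨z, hz, hd⟩ := hq u hu
    rw [mem_sphere_zero_iff_norm] at hz
    have h2 := hB u huB
    have h3 : ‖z‖ ≤ ‖(δ : ℂ) * hexCenter u‖ + dist ((δ : ℂ) * hexCenter u) z := by
      rw [dist_comm, dist_eq_norm]; exact norm_le_norm_add_norm_sub' z _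
    have h4 : R + 5 * δ ≤ M := h₁.trans (le_max_left _ _)
    linarith
  exact (hp₁.trans hq').trans hp₂.symm

end Summit.CriticalPhenomena.SAWScalingLimit.Theorems.ObservableToSLE.FloorRatio

end
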